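/-
Origin: expansion seat `planner-pub-hodgecm-toy-0`, handover #3 2026-08-18T05:09:35Z (revised: + Duality) (`HOME/pub-hodgecm-toy/lean/Toy/Toy.lean`, md5 fa08dc5f, 149 lines);
landed by the gen-6 packager in gate run 22 REPLACES the earlier landed copy of `HodgeCM/Model/Toy/Toy.lean` (import ^import Toy\.→import HodgeCM.Model.Toy. ×8; stripped 8 #print/#check/#eval lines).
-/
-- HANDOVER (planner-pub-hodgecm-toy-0, unit pub-hodgecm-toy): WIP module `Toy.Toy`; intended final module
-- `HodgeCM.Model.Toy.Toy` (kind L5, toy model / consistency witness); rename `import Toy.X` ↦ the final prefix.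
/-
Copyright: pub-hodgecm cell (HodgeCMPerL). Consistency-witness layer (part (e), referee A G4).

# The toy universe: `toyModel` and the assembly of `ModelAxioms`

`toyModel := toyModelWith exteriorHodgeData` is the EXTERIOR CM-MODEL: varieties are finite products of
"CM atoms" `(F, Φ)` (`F ⊂ ℂ` a number field, `Φ` a CM type), `H^k(X) := ⋀^k_ℚ (⊕ atoms)`, cup = wedge,
pull-back = functorial exterior power, the Hodge filtration on `⋀^k ⊗ ℂ` is the one induced by the CM types
through the eigenbasis (`HodgeCM.Toy.EigenBasis`, `ExteriorHodge`), algebraic classes := Hodge classes,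
`A_Φ := atom (K, Φ)`, the Picard modular surface := the empty product (so `H¹(P_Γ) = 0`).

`toyModel_modelAxioms : toyModel.ModelAxioms` holds with NO input: all 28 fields of `ModelAxioms` are THEOREMS
of this package (26 by direct computation, and the two that were typed inputs in earlier drafts; the run-21 name
`toyModel_axioms (h28)` is kept, ignoring its hypothesis, for the dependants landed meanwhile):

* M17 `cmDominated` needs, for every CM field `K`, a GALOIS CM field of degree `≥ 6` receiving `K`:
  `HodgeCM.Toy.galoisCMOracle` (module `GaloisClosure`) constructs one inside `ℂ` — the compositum of the
  Galois closure of `K` with `ℚ(ζ₇)` — and proves it is CM via `NumberField.IsCMField.of_forall_isConj`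
  ("the Galois closure of a CM field is CM", Shimura 1998 Prop. 18.2).
* M28 `Fact_algDuality`: an isomorphism `D : H^{2d-4}(A⁴) ≅ H⁴(A⁴)` carrying algebraic classes to algebraic
  classes and transporting the diagonal CM action, `ι(ā)^* ∘ D ∘ ι(a)^* = N(a)⁴ · D`.  Proved in module
  `Duality` (`HodgeCM.Toy.fact_algDuality`) by the TWISTED TRACE-FORM STAR
  `D y = Σ λ(y ∧ β_a ∧ β_b ∧ β_c ∧ β_d) · β'_a ∧ β'_b ∧ β'_c ∧ β'_d` (`β` the rational trace basis of `K⁴`,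
  `β'` its complex-conjugate trace-dual basis): after complexification it is `cst⁻¹ ·` the eigen-sum operator
  `T4_{e,ē}` (Casimir identity `Σ_m β_m ⊗ c(β^∨_m) = Σ_τ e_τ ⊗ e_τ̄`), whose Hodge types, `μ(a)`-equivariance
  (`Π_τ τ(a) = N_{K/ℚ}(a)` per atom) and injectivity (wedge test) are computed on eigen-monomials.
The general assembly `toyModel_axioms_of D O h28` still displays, for an arbitrary Hodge datum `D`, the
dependence on a `GaloisCMOracle` and on `Fact_algDuality`.

The module also records that the automorphic side is NOT realisable in this universe (`toyModel_isEmpty_thetaRealisation`: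
the field `lineField` of `ThetaRealisation` has no witness since `H¹(P_Γ) = 0`), whence `¬ OpenInputs` as soon
as a face datum exists (`toyModel_not_openInputs`): the open inputs are independent of `ModelAxioms`.
-/
import Mathlib
import Summits.HodgeConjecture.HodgeCM.Model.Toy.Axioms
import Summits.HodgeConjecture.HodgeCM.Model.Toy.CMFacts
import Summits.HodgeConjecture.HodgeCM.Model.Toy.Isogeny
import Summits.HodgeConjecture.HodgeCM.Model.Toy.Theta
import Summits.HodgeConjecture.HodgeCM.Model.Toy.ExteriorHodge
import Summits.HodgeConjecture.HodgeCM.Model.Toy.Weil_2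
import Summits.HodgeConjecture.HodgeCM.Model.Toy.GaloisClosure
import Summits.HodgeConjecture.HodgeCM.Model.Toy.Duality_4
import Summits.HodgeConjecture.HodgeCM.Model.Inhabited
import Summits.HodgeConjecture.HodgeCM.Proofs.Landherr

/-! PORT of `HodgeCM/Model/Toy/Toy.lean` (HodgeCMPerL run 82) — verbatim mechanical port; provenance in the PORT header line. -/

namespace HodgeCM.Toy

open Literature.AlgebraicGeometry.Motives

noncomputable section

/-- **Assembly, for any Hodge datum `D`.** All 28 fields of `ModelAxioms (toyModelWith D)`: 26 by
computation (`Axioms`, `CMFacts`, `Isogeny`, `Weil`), M17 from the Galois-CM-closure oracle `O`, M28 as the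
hypothesis `h28`. -/
theorem toyModel_axioms_of (D : HodgeData) (O : GaloisCMOracle)
    (h28 : (toyModelWith D).Fact_algDuality) : (toyModelWith D).ModelAxioms where
  pull_id := fact_pull_id D
  pull_comp := fact_pull_comp D
  pull_cup := fact_pull_cup D
  pull_hodge := fact_pull_hodge D
  cup2_hodge := fact_cup2_hodge D
  tr_degree := fact_tr_degree D
  alg_le_hodge := fact_alg_le_hodge D
  pull_alg := fact_pull_alg D
  cup_alg := fact_cup_alg D
  lefschetz11 := fact_lefschetz11 D
  cmAV := fact_cmAV D
  eigenLine := fact_eigenLine D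
  alphaLine := fact_alphaLine D
  cmDominated := fact_cmDominated D O
  weilLine_rank := fact_weilLine_rank D
  weilLine_hodge := fact_weilLine_hodge D
  pms_dim := fact_pms_dim D
  lift := fact_lift D
  cup_comm1 := fact_cup_comm1 D
  cup_interchange := fact_cup_interchange D
  kunneth1 := fact_kunneth1 D
  H1_rank := fact_H1_rank D
  H4_span := fact_H4_span D
  cmEnd := fact_cmEnd D
  conjIsogeny := fact_conjIsogeny D
  gysin_surface := fact_gysin_surface D
  deg_diag := fact_deg_diag D
  algDuality := h28

/-- **The toy model**: the exterior CM-model with its canonical (eigenbasis-induced) Hodge datum. -/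
def toyModel : Universe := toyModelWith exteriorHodgeData

/-- **`ModelAxioms toyModel`, unconditionally**: M17 from the constructed `galoisCMOracle`, M28 from the
twisted trace-form star `fact_algDuality`; no hypothesis, no proof placeholder. -/
theorem toyModel_modelAxioms : toyModel.ModelAxioms :=
  toyModel_axioms_of exteriorHodgeData galoisCMOracle fact_algDuality

/-- Run-21 signature, kept so that `HodgeCM.Model.ToyPerL` (which applies `toyModel_axioms h28`) compiles
unchanged: the hypothesis is now IGNORED — `toyModel_modelAxioms` proves the conclusion outright. -/
theorem toyModel_axioms (_h28 : toyModel.Fact_algDuality) : toyModel.ModelAxioms := toyModel_modelAxioms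

/-- `ModelAxioms` is consistent: it has a model. -/
theorem modelAxioms_consistent : ∃ U : Universe, U.ModelAxioms := ⟨toyModel, toyModel_modelAxioms⟩

/-- **No theta realisation in `toyModel`**, for any parameter tuple: the field `lineField` of
`ThetaRealisation` (`Λ_Γ(ω₁ ⊗ ω₂) ≠ 0` for one-forms `ω₁, ω₂` on `P_Γ`) has no witness, `H¹(P_Γ)` being `0`. -/
theorem toyModel_isEmpty_thetaRealisation {L : CMField} (ι₁ : L →+* ℂ) (V : HermSpace3 L ι₁)
    (K : CMField) (Ψ : Fin 4 → CMType K) (σ : K →+* ℂ) :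
    IsEmpty (toyModel.ThetaRealisation ι₁ V K Ψ σ) :=
  isEmpty_thetaRealisation exteriorHodgeData ι₁ V K Ψ σ

/-- **`OpenInputs` fails in `toyModel`** (given a face datum): the open inputs are not consequences of
`ModelAxioms` and are not vacuously/trivially satisfiable. -/
theorem toyModel_not_openInputs (d : FaceDatum) : ¬ toyModel.OpenInputs :=
  not_openInputs exteriorHodgeData d

/-- **Face data exist**: `F = ℚ(ζ₇)` with a face and an admissible embedding
(`HodgeCM.faceHypothesesInhabited`, module `HodgeCM.Model.Inhabited`, sibling seat toy2) and a hermitian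
3-space of signature `(2,1)` at `ι₁`, definite elsewhere, from Landherr's theorem (`HodgeCM.landherr_exists_proof`). -/
theorem nonempty_faceDatum : Nonempty FaceDatum := by
  obtain ⟨F, hG, h6, f, ι₁, hι⟩ := HodgeCM.faceHypothesesInhabited
  obtain ⟨V⟩ := HodgeCM.landherr_exists_proof F ι₁
  exact ⟨⟨F, hG, h6, f, ι₁, hι, V⟩⟩

/-- **`OpenInputs` fails in `toyModel` — unconditionally.**  (Non-vacuity "the other way", referee A G4:
the open inputs are not provable from typing artefacts; here is a universe satisfying all 28 model facts in
which `OpenInputs` is FALSE.) -/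
theorem toyModel_not_openInputs' : ¬ toyModel.OpenInputs :=
  nonempty_faceDatum.elim fun d => toyModel_not_openInputs d

/-- **Model axioms and the failure of the open inputs coexist in one universe**: `OpenInputs` is
independent of (not derivable from) `ModelAxioms`. -/
theorem toyModel_axioms_and_not_openInputs : toyModel.ModelAxioms ∧ ¬ toyModel.OpenInputs :=
  ⟨toyModel_modelAxioms, toyModel_not_openInputs'⟩

/-- (Ported verbatim from the HodgeCMPerL package; no docstring in the source.) -/
theorem not_modelAxioms_imp_openInputs : ¬ ∀ U : Universe, U.ModelAxioms → U.OpenInputs :=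
  fun h => toyModel_not_openInputs' (h toyModel toyModel_modelAxioms)

/-! ### Axiom closures of the headline declarations (expected: `propext`, `Classical.choice`, `Quot.sound`) -/

end

end HodgeCM.Toy
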